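import Summits.Schanuel.Schanuel.Theorems.SoloInformedFloorTorsion

/-!
# The bilinear floor: rational relations among `1, e, π, eπ` (soloist Proposition W)

Soloist file (`solo-Schanuel-informed`, residency session s15, 2026-08-19), companion of
`SoloInformedFloorTorsion` (Proposition T: the floor "`1, e, π` `ℚ`-linearly independent,
`π/e ∉ ℚ`, `eπ ∉ ℚ`" below `e ⟂ π`).  Session s15 audited the soloist's engine census against
the linear-form and continued-fraction engines (Nesterenko's linear independence criterion,
Hurwitz continued fractions); the one structural fact those engines can see at the point
`(e, π)` is recorded here, kernel-checked.  Nothing is deep; the point is the exact typing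
(atlas §1 F4‴, §2 E19 of the soloist's statement).

## Statements

Write `W = ℚ + ℚe + ℚπ + ℚeπ ⊂ ℝ` for the `ℚ`-span of `1, e, π, eπ`.

* §1 (unconditional).  EITHER `1, e, π` OR `1, e, eπ` is a `ℚ`-linearly independent triple
  (`linearIndependent_one_e_pi_or_one_e_epi`) — if both failed, `π = a + be` and `eπ = c + de`
  with rational `a, b, c, d`, so `be² + (a − d)e − c = 0`: `b ≠ 0` contradicts Hermite (`e` is
  transcendental, tree fact `transcendental_exp_one_holds`) and `b = 0` makes `π = a` rational.
  Hence `3 ≤ dim_ℚ W ≤ 4` (`three_le_finrank_span`, `finrank_span_le_four`): the `ℚ`-linear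
  relations among `1, e, π, eπ` form a space of dimension `≤ 1`.  Instances: at most one of the
  three numbers `e + π`, `eπ`, `π/e` is rational (`expOneAddPiIrrational_or_irrational_pi_div`,
  `expOneMulPiIrrational_or_irrational_pi_div`, with the classical third pair
  `Literature.NumberTheory.Transcendental.transcendental_exp_one_add_pi_or_mul_pi.irrational_or`).
* §2 (the open statement).  `BilinearFloor :⟺ 1, e, π, eπ` are `ℚ`-linearly independent, i.e.
  `dim_ℚ W = 4` (`bilinearFloor_iff_finrank_eq_four`), i.e. no non-zero INTEGER bilinear form
  `a + be + cπ + deπ` vanishes (`bilinearFloor_iff_intForms`), i.e. `π` is not a rational Möbius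
  image `(ae + b)/(ce + d)` of `e` (`not_bilinearFloor_iff_moebius`).  By §1 at most one relation
  line is missing and we cannot say which: no SPECIFIC triple among `1, e, π, eπ` is known to be
  `ℚ`-linearly independent.
* §3 (summit side).  `e ⟂ π ⟹ BilinearFloor ⟹` Proposition T's floor and `e + π ∉ ℚ`
  (`bilinearFloor_of_expOnePiAlgebraicIndependent`, `floor_of_bilinearFloor`); the summit gives
  it (`bilinearFloor_of_schanuel`).

## Reading (atlas §2 E19, §3 r63–r64)

Nesterenko's criterion [Nesterenko1985; quoted from FischlerRivoal2012, Théorème 3 with `k = 1`]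
would give `dim_ℚ W ≥ 3` from integer forms `|p₀ + p₁e + p₂π + p₃eπ| = H^{-τ + o(1)}` with
`τ > 1`, and `dim_ℚ W = 4` (`BilinearFloor`) from `τ > 2`.  The forms in print are sums and
products of the Hermite–Padé forms in `1, e` (exponent `τ_e = 1`) and the hypergeometric forms
in `1, π` (`τ_π ≈ 0.16`, from the irrationality measure `μ(π) ≤ 7.103…`
[ZeilbergerZudilin2020]); exponents of products combine convexly and sums are dominated by the
worse summand, so `τ ≤ 1` and the criterion certifies only `dim_ℚ W ≥ 2` — less than §1, which
is elementary ("the joint irrationality measure `r(e, π) ≤ max{r(e), r(π)}`, but no one has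
improved on this bound" [Finch2003, §2.22]).  On the continued-fraction side, `¬ BilinearFloor`
says that `π` lies in the `GL₂(ℚ)`-orbit of `e`, hence [Hurwitz1896] has a continued fraction
of Hurwitz type, as `e = [2; 1, 2k, 1]_{k ≥ 1}` does; no theorem on the continued fraction of
`π` excludes this.  `BilinearFloor` is open, and so is each of its named sub-statements
`e + π ∉ ℚ`, `eπ ∉ ℚ` [Angell2021, §1.4] and `π/e ∉ ℚ` [Finch2003, §2.22: "we do not even know
whether `e` and `π` are linearly independent over the rationals"].

## References

* [Nesterenko1985] Yu. V. Nesterenko, On the linear independence of numbers, Vestnik Moskov.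
  Univ. Ser. I (1985) no. 1, 46–49 (Moscow Univ. Math. Bull. 40 (1985) 69–74); quoted from
  [FischlerRivoal2012] S. Fischler, T. Rivoal, Approximants de Padé et séries hypergéométriques
  équilibrées, J. Math. Pures Appl. (2003) / arXiv:1202.2279, Théorème 3 (p. 4).
* [ZeilbergerZudilin2020] D. Zeilberger, W. Zudilin, The irrationality measure of `π` is at most
  `7.103205334137…`, Moscow J. Combin. Number Theory 9 (2020) 407–419 (arXiv:1912.06345).
* [Hurwitz1896] A. Hurwitz, Über die Kettenbrüche, deren Teilnenner arithmetische Reihen bilden,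
  Vierteljahrsschrift Naturforsch. Ges. Zürich 41 (1896) 34–64; quoted from R. T. Bumby,
  M. E. Flahive, Continued fractions with partial quotients in arithmetic progression
  (arXiv:0710.0399), pp. 1–2.
* [Angell2021] D. Angell, *Irrationality and Transcendence in Number Theory*, CRC Press 2022,
  Ch. 1 §1.4 (`e + π`, `eπ`: "at least one must be irrational …").
* [Finch2003] S. R. Finch, *Mathematical Constants*, Cambridge Univ. Press 2003, §2.22
  (Liouville–Roth constants), closing paragraph on the joint irrationality measure `r(e, π)`.
-/

noncomputable section

open Complex IntermediateField
open Literature.NumberTheory.Transcendental (ExpOnePiAlgebraicIndependent SchanuelRank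
  ExpOneAddPiIrrational ExpOneMulPiIrrational transcendental_exp_one_holds)

namespace Summit.Schanuel.Schanuel.Theorems

/-! ### §0 Elementary facts about `e` -/

/-- `e²` is irrational (`e` is not a root of `X² − q`, by Hermite). -/
theorem irrational_exp_one_sq : Irrational (Real.exp 1 ^ 2) := by
  rintro ⟨q, hq⟩
  refine transcendental_exp_one_holds ⟨Polynomial.X ^ 2 - Polynomial.C q,
    Polynomial.X_pow_sub_C_ne_zero two_pos q, ?_⟩
  simp only [map_sub, map_pow, Polynomial.aeval_X, Polynomial.aeval_C, eq_ratCast, hq, sub_self]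

/-- `1, e` are `ℚ`-linearly independent (irrationality of `e`). -/
theorem linearIndependent_one_exp_one : LinearIndependent ℚ ![(1 : ℝ), Real.exp 1] := by
  rw [LinearIndependent.pair_iff]
  intro s t hst
  rw [Rat.smul_one_eq_cast, Rat.smul_def] at hst
  by_cases ht : t = 0
  · subst ht
    simp only [Rat.cast_zero, zero_mul, add_zero, Rat.cast_eq_zero] at hst
    exact ⟨hst, rfl⟩
  · exfalso
    have ht' : (t : ℝ) ≠ 0 := by exact_mod_cast ht
    refine transcendental_exp_one_holds.irrational ⟨-s / t, ?_⟩
    push_cast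
    rw [div_eq_iff ht']
    linear_combination -hst

/-- The algebraic heart of §1: `π ∈ ℚ + ℚe` and `eπ ∈ ℚ + ℚe` cannot both hold
(`b ≠ 0`: `e` would be quadratic; `b = 0`: `π` would be rational). -/
theorem false_of_pi_and_exp_one_mul_pi_mem_span {a b c d : ℚ}
    (hab : (a : ℝ) + b * Real.exp 1 = Real.pi)
    (hcd : (c : ℝ) + d * Real.exp 1 = Real.exp 1 * Real.pi) : False := by
  by_cases hb : b = 0
  · subst hb
    simp only [Rat.cast_zero, zero_mul, add_zero] at hab
    exact irrational_pi ⟨a, hab⟩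
  · refine transcendental_exp_one_holds ⟨Polynomial.C b * Polynomial.X ^ 2 +
      Polynomial.C (a - d) * Polynomial.X - Polynomial.C c, ?_, ?_⟩
    · intro h0
      have h2 := congrArg (fun p => Polynomial.coeff p 2) h0
      simp only [Polynomial.coeff_sub, Polynomial.coeff_add, Polynomial.coeff_C_mul,
        Polynomial.coeff_X_pow, Polynomial.coeff_X, Polynomial.coeff_C, Polynomial.coeff_zero,
        if_true, mul_one] at h2
      norm_num at h2
      exact hb h2
    · simp only [map_sub, map_add, map_mul, map_pow, Polynomial.aeval_X, Polynomial.aeval_C,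
        eq_ratCast]
      linear_combination (Real.exp 1) * hab - hcd

/-- A dependent triple `1, e, y` puts `y` in `ℚ + ℚe`. -/
theorem exists_rat_of_not_linearIndependent {y : ℝ}
    (h : ¬ LinearIndependent ℚ ![(1 : ℝ), Real.exp 1, y]) :
    ∃ a b : ℚ, (a : ℝ) + b * Real.exp 1 = y := by
  rw [Fintype.not_linearIndependent_iff] at h
  obtain ⟨g, hg, i, hi⟩ := h
  simp only [Fin.sum_univ_three, Matrix.cons_val_zero, Matrix.cons_val_one, Matrix.cons_val,
    Rat.smul_def, mul_one] at hg
  -- `hg : g 0 + g 1 * e + g 2 * y = 0`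
  by_cases h2 : g 2 = 0
  · exfalso
    rw [h2, Rat.cast_zero, zero_mul, add_zero] at hg
    have h01 := (LinearIndependent.pair_iff.mp linearIndependent_one_exp_one) (g 0) (g 1)
      (by rw [Rat.smul_one_eq_cast, Rat.smul_def]; exact hg)
    fin_cases i
    · exact hi h01.1
    · exact hi h01.2
    · exact hi h2
  · have h2' : (g 2 : ℝ) ≠ 0 := by exact_mod_cast h2
    have hy : y = (-(g 0 : ℝ) - g 1 * Real.exp 1) / g 2 := by
      rw [eq_div_iff h2']
      linear_combination hg
    refine ⟨-g 0 / g 2, -g 1 / g 2, ?_⟩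
    push_cast
    rw [hy]
    ring

/-! ### §1 Unconditional: an independent triple, `3 ≤ dim_ℚ (ℚ + ℚe + ℚπ + ℚeπ) ≤ 4` -/

/-- **Proposition W (i).** Either `1, e, π` or `1, e, eπ` is a `ℚ`-linearly independent triple
(and we cannot say which). -/
theorem linearIndependent_one_e_pi_or_one_e_epi :
    LinearIndependent ℚ ![(1 : ℝ), Real.exp 1, Real.pi] ∨
      LinearIndependent ℚ ![(1 : ℝ), Real.exp 1, Real.exp 1 * Real.pi] := by
  by_contra h
  rw [not_or] at h
  obtain ⟨a, b, hab⟩ := exists_rat_of_not_linearIndependent h.1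
  obtain ⟨c, d, hcd⟩ := exists_rat_of_not_linearIndependent h.2
  exact false_of_pi_and_exp_one_mul_pi_mem_span hab hcd

/-- **Proposition W (i), dimension form.** The `ℚ`-span of `1, e, π, eπ` has dimension `≥ 3`:
the `ℚ`-linear relations among these four numbers form a space of dimension at most `1`. -/
theorem three_le_finrank_span :
    3 ≤ (Set.range ![(1 : ℝ), Real.exp 1, Real.pi, Real.exp 1 * Real.pi]).finrank ℚ := by
  show 3 ≤ Module.finrank ℚ (Submodule.span ℚ
    (Set.range ![(1 : ℝ), Real.exp 1, Real.pi, Real.exp 1 * Real.pi]))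
  set W := Submodule.span ℚ
    (Set.range ![(1 : ℝ), Real.exp 1, Real.pi, Real.exp 1 * Real.pi]) with hW
  haveI : FiniteDimensional ℚ W := FiniteDimensional.span_of_finite ℚ (Set.finite_range _)
  have key : ∀ y : ℝ, y ∈ W → LinearIndependent ℚ ![(1 : ℝ), Real.exp 1, y] →
      3 ≤ Module.finrank ℚ W := by
    intro y hy hli
    have hle : Submodule.span ℚ (Set.range ![(1 : ℝ), Real.exp 1, y]) ≤ W := by
      rw [Submodule.span_le]
      rintro _ ⟨i, rfl⟩
      fin_cases i
      · exact Submodule.subset_span ⟨0, rfl⟩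
      · exact Submodule.subset_span ⟨1, rfl⟩
      · simpa using hy
    calc 3 = Module.finrank ℚ (Submodule.span ℚ (Set.range ![(1 : ℝ), Real.exp 1, y])) := by
          rw [finrank_span_eq_card hli, Fintype.card_fin]
      _ ≤ Module.finrank ℚ W := Submodule.finrank_mono hle
  rcases linearIndependent_one_e_pi_or_one_e_epi with h | h
  · exact key _ (Submodule.subset_span ⟨2, rfl⟩) h
  · exact key _ (Submodule.subset_span ⟨3, rfl⟩) h

/-- … and dimension `≤ 4`, trivially. -/
theorem finrank_span_le_four :
    (Set.range ![(1 : ℝ), Real.exp 1, Real.pi, Real.exp 1 * Real.pi]).finrank ℚ ≤ 4 := by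
  simpa using
    finrank_range_le_card (R := ℚ) ![(1 : ℝ), Real.exp 1, Real.pi, Real.exp 1 * Real.pi]

/-- **At most one of `e + π`, `π/e` is rational** (the pair would span two independent
relations among `1, e, π, eπ`; directly: `e(1 + r) = s`). -/
theorem expOneAddPiIrrational_or_irrational_pi_div :
    ExpOneAddPiIrrational ∨ Irrational (Real.pi / Real.exp 1) := by
  show Irrational (Real.exp 1 + Real.pi) ∨ _
  by_contra h
  simp only [not_or, Irrational, not_not, Set.mem_range] at h
  obtain ⟨⟨s, hs⟩, ⟨r, hr⟩⟩ := h
  have he : Real.exp 1 ≠ 0 := (Real.exp_pos 1).ne'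
  have hpi : Real.pi = r * Real.exp 1 := by rw [hr, div_mul_cancel₀ _ he]
  have h1r : (1 : ℝ) + r ≠ 0 := by
    intro h0
    have : Real.exp 1 + Real.pi = 0 := by rw [hpi]; linear_combination Real.exp 1 * h0
    linarith [Real.exp_pos 1, Real.pi_pos]
  exact transcendental_exp_one_holds.irrational ⟨s / (1 + r), by
    push_cast
    rw [div_eq_iff h1r, hs, hpi]
    ring⟩

/-- **At most one of `eπ`, `π/e` is rational** (directly: `e² = p/r`). -/
theorem expOneMulPiIrrational_or_irrational_pi_div :
    ExpOneMulPiIrrational ∨ Irrational (Real.pi / Real.exp 1) := by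
  show Irrational (Real.exp 1 * Real.pi) ∨ _
  by_contra h
  simp only [not_or, Irrational, not_not, Set.mem_range] at h
  obtain ⟨⟨p, hp⟩, ⟨r, hr⟩⟩ := h
  have he : Real.exp 1 ≠ 0 := (Real.exp_pos 1).ne'
  have hpi : Real.pi = r * Real.exp 1 := by rw [hr, div_mul_cancel₀ _ he]
  have hr0 : (r : ℝ) ≠ 0 := by
    intro h0
    rw [h0, zero_mul] at hpi
    exact Real.pi_ne_zero hpi
  exact irrational_exp_one_sq ⟨p / r, by
    push_cast
    rw [div_eq_iff hr0, hp, hpi]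
    ring⟩

/-- Summary of §1's instances: **at most one of the three numbers `e + π`, `eπ`, `π/e` is
rational** (the third pair is the classical "`e + π` or `eπ` is transcendental"). -/
theorem atMostOne_rational_add_mul_div :
    (ExpOneAddPiIrrational ∨ ExpOneMulPiIrrational) ∧
      (ExpOneAddPiIrrational ∨ Irrational (Real.pi / Real.exp 1)) ∧
      (ExpOneMulPiIrrational ∨ Irrational (Real.pi / Real.exp 1)) :=
  ⟨Literature.NumberTheory.Transcendental.transcendental_exp_one_add_pi_or_mul_pi.irrational_or
      Literature.NumberTheory.Transcendental.transcendental_exp_one_add_pi_or_mul_pi_holds,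
    expOneAddPiIrrational_or_irrational_pi_div, expOneMulPiIrrational_or_irrational_pi_div⟩

/-! ### §2 The open statement: the bilinear floor -/

/-- OPEN — **the bilinear floor below `e ⟂ π`**: `1, e, π, eπ` are linearly independent over
`ℚ`; equivalently no non-zero integer bilinear form `a + be + cπ + deπ` vanishes, equivalently
`π ∉ {(ae + b)/(ce + d) : a, b, c, d ∈ ℚ}`.  It is the degree-`(1,1)` truncation of the
algebraic independence of `e` and `π` and contains the open irrationality of `e + π`, of `eπ`
[cite: Angell2021, Ch. 1 §1.4 ("most likely, both are irrational, this has not been proved for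
either one individually")] and of `π/e`; unconditionally only `dim_ℚ ≥ 3` is known (§1). -/
@[conjecture] def BilinearFloor : Prop :=
  LinearIndependent ℚ ![(1 : ℝ), Real.exp 1, Real.pi, Real.exp 1 * Real.pi]

/-- `BilinearFloor ⟺ dim_ℚ (ℚ + ℚe + ℚπ + ℚeπ) = 4`. -/
theorem bilinearFloor_iff_finrank_eq_four :
    BilinearFloor ↔
      (Set.range ![(1 : ℝ), Real.exp 1, Real.pi, Real.exp 1 * Real.pi]).finrank ℚ = 4 := by
  rw [BilinearFloor, linearIndependent_iff_card_eq_finrank_span, Fintype.card_fin, eq_comm]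

/-- `BilinearFloor` is the vanishing criterion for INTEGER bilinear forms in `(1, e) ⊗ (1, π)`. -/
theorem bilinearFloor_iff_intForms :
    BilinearFloor ↔ ∀ a b c d : ℤ,
      (a : ℝ) + b * Real.exp 1 + c * Real.pi + d * (Real.exp 1 * Real.pi) = 0 →
        a = 0 ∧ b = 0 ∧ c = 0 ∧ d = 0 := by
  unfold BilinearFloor
  rw [← LinearIndependent.iff_fractionRing ℤ ℚ, Fintype.linearIndependent_iff]
  constructor
  · intro h a b c d habcd
    have h0 := h ![a, b, c, d] (by simpa [Fin.sum_univ_four, zsmul_eq_mul] using habcd)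
    exact ⟨by simpa using h0 0, by simpa using h0 1, by simpa using h0 2, by simpa using h0 3⟩
  · intro h g hg
    have h4 := h (g 0) (g 1) (g 2) (g 3) (by simpa [Fin.sum_univ_four, zsmul_eq_mul] using hg)
    intro i
    fin_cases i
    · exact h4.1
    · exact h4.2.1
    · exact h4.2.2.1
    · exact h4.2.2.2

/-- **`¬ BilinearFloor ⟺ π` is a rational Möbius image of `e`**: `π (ce + d) = ae + b` for some
rationals with `(c, d) ≠ (0, 0)` (then automatically `ad − bc ≠ 0`, as `π ∉ ℚ`). -/
theorem not_bilinearFloor_iff_moebius :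
    ¬ BilinearFloor ↔ ∃ a b c d : ℚ, (c ≠ 0 ∨ d ≠ 0) ∧
      Real.pi * (c * Real.exp 1 + d) = a * Real.exp 1 + b := by
  unfold BilinearFloor
  rw [Fintype.not_linearIndependent_iff]
  constructor
  · rintro ⟨g, hg, i, hi⟩
    simp only [Fin.sum_univ_four, Matrix.cons_val_zero, Matrix.cons_val_one, Matrix.cons_val,
      Rat.smul_def, mul_one] at hg
    -- `hg : g 0 + g 1 * e + g 2 * π + g 3 * (e * π) = 0`
    refine ⟨-g 1, -g 0, g 3, g 2, ?_, by push_cast; linear_combination hg⟩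
    by_contra h32
    simp only [not_or, not_not] at h32
    obtain ⟨h3, h2⟩ := h32
    rw [h3, h2, Rat.cast_zero, zero_mul, zero_mul, add_zero, add_zero] at hg
    have h01 := (LinearIndependent.pair_iff.mp linearIndependent_one_exp_one) (g 0) (g 1)
      (by rw [Rat.smul_one_eq_cast, Rat.smul_def]; exact hg)
    fin_cases i
    · exact hi h01.1
    · exact hi h01.2
    · exact hi h2
    · exact hi h3
  · rintro ⟨a, b, c, d, hcd, h⟩
    refine ⟨![-b, -a, d, c], ?_, ?_⟩
    · simp only [Fin.sum_univ_four, Matrix.cons_val_zero, Matrix.cons_val_one, Matrix.cons_val,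
        Rat.smul_def, mul_one]
      push_cast
      linear_combination h
    · rcases hcd with hc | hd
      · exact ⟨3, by simpa using hc⟩
      · exact ⟨2, by simpa using hd⟩

/-! ### §3 Summit side -/

/-- `e ⟂ π` kills every non-trivial integer bilinear form in `(1, e) ⊗ (1, π)`. -/
theorem intBilinearForms_of_expOnePiAlgebraicIndependent (h : ExpOnePiAlgebraicIndependent)
    (a b c d : ℤ)
    (habcd : (a : ℝ) + b * Real.exp 1 + c * Real.pi + d * (Real.exp 1 * Real.pi) = 0) :
    a = 0 ∧ b = 0 ∧ c = 0 ∧ d = 0 := by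
  set P : MvPolynomial (Fin 2) ℚ :=
    MvPolynomial.C (a : ℚ) + MvPolynomial.C (b : ℚ) * MvPolynomial.X 0 +
      MvPolynomial.C (c : ℚ) * MvPolynomial.X 1 +
      MvPolynomial.C (d : ℚ) * (MvPolynomial.X 0 * MvPolynomial.X 1) with hP
  have hPx : MvPolynomial.aeval ![Real.exp 1, Real.pi] P = 0 := by
    simp only [hP, map_add, map_mul, MvPolynomial.aeval_C, MvPolynomial.aeval_X,
      Matrix.cons_val_zero, Matrix.cons_val_one, Matrix.cons_val_fin_one, eq_ratCast,
      Rat.cast_intCast]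
    exact habcd
  have hP0 : P = 0 := h (by rw [hPx, map_zero])
  have e00 := congrArg (MvPolynomial.aeval ![(0 : ℚ), 0]) hP0
  have e10 := congrArg (MvPolynomial.aeval ![(1 : ℚ), 0]) hP0
  have e01 := congrArg (MvPolynomial.aeval ![(0 : ℚ), 1]) hP0
  have e11 := congrArg (MvPolynomial.aeval ![(1 : ℚ), 1]) hP0
  simp only [hP, map_add, map_mul, MvPolynomial.aeval_C, MvPolynomial.aeval_X, map_zero,
    Matrix.cons_val_zero, Matrix.cons_val_one, Matrix.cons_val_fin_one, mul_zero, mul_one,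
    add_zero, eq_ratCast, Rat.cast_intCast] at e00 e10 e01 e11
  have hb : (b : ℚ) = 0 := by linear_combination e10 - e00
  have hc : (c : ℚ) = 0 := by linear_combination e01 - e00
  have hd : (d : ℚ) = 0 := by linear_combination e11 - e10 - e01 + e00
  exact ⟨by exact_mod_cast e00, by exact_mod_cast hb, by exact_mod_cast hc, by exact_mod_cast hd⟩

/-- **`e ⟂ π ⟹ BilinearFloor`.** -/
theorem bilinearFloor_of_expOnePiAlgebraicIndependent (h : ExpOnePiAlgebraicIndependent) :
    BilinearFloor :=
  bilinearFloor_iff_intForms.mpr (intBilinearForms_of_expOnePiAlgebraicIndependent h)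

/-- **`BilinearFloor ⟹` the whole linear floor**: `1, e, π` `ℚ`-linearly independent
(Proposition T's F4′), `e + π ∉ ℚ`, `eπ ∉ ℚ`, `π/e ∉ ℚ`. -/
theorem floor_of_bilinearFloor (h : BilinearFloor) :
    LinearIndependent ℚ ![(1 : ℝ), Real.exp 1, Real.pi] ∧ ExpOneAddPiIrrational ∧
      ExpOneMulPiIrrational ∧ Irrational (Real.pi / Real.exp 1) := by
  rw [bilinearFloor_iff_intForms] at h
  have he : Real.exp 1 ≠ 0 := (Real.exp_pos 1).ne'
  refine ⟨?_, ?_, ?_, ?_⟩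
  · rw [linearIndependent_one_e_pi_iff]
    intro a b c habc
    have h3 := h a b c 0 (by push_cast; linear_combination habc)
    exact ⟨h3.1, h3.2.1, h3.2.2.1⟩
  · show Irrational (Real.exp 1 + Real.pi)
    rw [irrational_iff_ne_rational]
    intro a b hb hab
    rw [eq_div_iff (by exact_mod_cast hb : (b : ℝ) ≠ 0)] at hab
    exact hb (h (-a) b b 0 (by push_cast; linear_combination hab)).2.1
  · show Irrational (Real.exp 1 * Real.pi)
    rw [irrational_iff_ne_rational]
    intro a b hb hab
    rw [eq_div_iff (by exact_mod_cast hb : (b : ℝ) ≠ 0)] at hab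
    exact hb (h (-a) 0 0 b (by push_cast; linear_combination hab)).2.2.2
  · rw [irrational_iff_ne_rational]
    intro a b hb hab
    rw [div_eq_div_iff he (by exact_mod_cast hb : (b : ℝ) ≠ 0)] at hab
    exact hb (h 0 (-a) b 0 (by push_cast; linear_combination hab)).2.2.1

/-- **The summit gives the bilinear floor.** -/
theorem bilinearFloor_of_schanuel (h : _root_.Schanuel) : BilinearFloor :=
  bilinearFloor_of_expOnePiAlgebraicIndependent
    (expOnePiAlgebraicIndependent_of_schanuelRank_two (h 2))

end Summit.Schanuel.Schanuel.Theorems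

end
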